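import Summits.BirchSwinnertonDyer.BirchSwinnertonDyer.Theorems.AdditiveKolyvaginRoadKolyvaginSupplyOfPoitouTate
import HarnessLib

/-!
# Route `AdditiveKolyvaginRoad`, crux `LevelKolyvaginSystemsAdditive` (item stmt-BirchSwinnertonDyer-21396, KS′):
# the STRONG signed jump at a Kolyvagin prime — a signed class of the relaxed structure SEEN at `λ` and ISOTROPIC there
# (cell `pub/bsd-wall`, width seat `bsd-wall-akr-p2x-w3` g7; `--supports stmt-BirchSwinnertonDyer-21396`, helper; with `…KolyvaginAxisLemma`
# the E-side input of the RAISE half of the twin dichotomy for the mixed level spaces)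

WHY/WHAT. akr-p1's `supply_signed_of_jumpP` (W. Zhang Lemma 8.2 via McCallum Lemma 5.3) records only that each sign has a NON-ZERO class
in the relaxed group `G(n, ℓ, T)`; its proof (`ZhangSupply.exists_eigen_not_mem_of_jump` + the (REC) isotropy) gives a class NON-ZERO AT `λ`
with ISOTROPIC `λ`-localisation. §1 `supply_signed_strong_of_jumpP` ∕ `supply_signed_strong_of_jump_boundP` re-run it keeping that
conclusion (binders verbatim; (Stab) discharged as akr-p1 did); §2 `strongSupply_of_poitouTateP` assembles it from the Poitou–Tate fact
for ANY Weil-type pairing `e`, in place currency and in the cup-product currency of the axis lemma (`b = inv ∘ ∪ₑ`, `inv_λ` injective).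

HONEST FRAMING: theorems only; 0 definitions, 0 named facts, 0 `sorry`; CONDITIONAL on the named PT fact where stated; closes nothing.
BSD is not proved by any of this.

References: [cite: WZhang2014, §8.1, Lemma 8.2] [cite: McCallumLMS1991, Prop. 2.1, Lemma 5.3] [cite: GrossLMS1991, §5 (5.1), Prop. 8.1]
[cite: MilneADT2006, Ch. I, Cor. 2.3, Thm. 4.10].
-/

-- single-conjunct summit: `Summit.BirchSwinnertonDyer.BirchSwinnertonDyer.…` repeats the name by design
set_option linter.dupNamespace false

noncomputable section

open scoped Classical

namespace Summit.BirchSwinnertonDyer.BirchSwinnertonDyer.Theorems.AdditiveKoly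

open Function WeierstrassCurve NumberField IsDedekindDomain Field
  Literature.NumberTheory.EllipticCurves Literature.NumberTheory.EllipticCurves.ModularForms
  Literature.NumberTheory.GaloisRepresentations Module
open Literature.NumberTheory.GaloisCohomology
open Summit.BirchSwinnertonDyer.Rank1Residual.X11b.Three.Koly.Method2
open Summit.BirchSwinnertonDyer.Rank1Residual.X11b.Three.Koly.ZhangSupply
open Summit.BirchSwinnertonDyer.Rank1Residual.X11b

variable (W : WeierstrassCurve ℚ) (K : Type) [Field K] [NumberField K] (p : ℕ)
variable [W.IsGloballyMinimal] [Fact p.Prime] (ι : K →+* ℂ) (c : K ≃ₐ[ℚ] K)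
  [Module (ZMod p) (Vp W K p)]
  [∀ v : Place K, Module (ZMod p)
    (galoisCohomology (((W.baseChange K).torsionGaloisModule ((p ^ 1 : ℕ) : ℤ)).toLocal v) 1)]

/-! ## §1 The strong signed jump from (J), (Stab), (IsoBound) -/

/-- **The STRONG signed supply** (binders of `supply_signed_of_jumpP` verbatim): for `n ≠ ∅`, Kolyvagin `ℓ ∉ T`, sign `s`, a class of
sign `s` in `G(n, ℓ, T)` NON-ZERO AT `λ = plK ℓ` with ISOTROPIC `λ`-localisation (akr-p1's proof, keeping what it gives).
[cite: WZhang2014, Lemma 8.2] [cite: McCallumLMS1991, Prop. 2.1, Lemma 5.3] [cite: GrossLMS1991, Prop. 8.1] -/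
theorem supply_signed_strong_of_jumpP (hp2 : p ≠ 2) (hc2 : c * c = 1)
    (loc : (v : Place K) → Vp W K p →ₗ[ZMod p]
      galoisCohomology (((W.baseChange K).torsionGaloisModule ((p ^ 1 : ℕ) : ℤ)).toLocal v) 1)
    (hloc : ∀ (v : Place K) (x : Vp W K p),
      loc v x = galoisCohomology.localization ((W.baseChange K).torsionGaloisModule ((p ^ 1 : ℕ) : ℤ)) v 1 x)
    (plK : {ℓ // Zhang2014.IsKolyvaginPrime (W.conductorNorm ℤ) W K p ℓ} → HeightOneSpectrum (𝓞 K))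
    (b : (v : Place K) →
      galoisCohomology (((W.baseChange K).torsionGaloisModule ((p ^ 1 : ℕ) : ℤ)).toLocal v) 1 →ₗ[ZMod p]
      galoisCohomology (((W.baseChange K).torsionGaloisModule ((p ^ 1 : ℕ) : ℤ)).toLocal v) 1 →ₗ[ZMod p] ZMod p)
    (hrec : ∀ (x y : Vp W K p) (T : Finset (Place K)), (∀ v, v ∉ T → b v (loc v x) (loc v y) = 0) →
      ∑ v ∈ T, b v (loc v x) (loc v y) = 0)
    (hisoKum : ∀ (v : Place K),
      ∀ x ∈ (W.baseChange K).kummerLocalConditionAt ((p ^ 1 : ℕ) : ℤ) (Place.Completion v),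
      ∀ y ∈ (W.baseChange K).kummerLocalConditionAt ((p ^ 1 : ℕ) : ℤ) (Place.Completion v), b v x y = 0)
    (hisoTor : ∀ (q : AdmQ W K p) (v : HeightOneSpectrum (𝓞 K)), ((q : ℕ) : 𝓞 K) ∈ v.asIdeal →
      ∀ (x y : Vp W K p),
      x ∈ toricLocalKer (W.baseChange K) (v.adicCompletion K) ((p ^ 1 : ℕ) : ℤ) →
      y ∈ toricLocalKer (W.baseChange K) (v.adicCompletion K) ((p ^ 1 : ℕ) : ℤ) →
      b (Sum.inr v) (loc (Sum.inr v) x) (loc (Sum.inr v) y) = 0)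
    (hisoTr : ∀ (ℓ : {ℓ // Zhang2014.IsKolyvaginPrime (W.conductorNorm ℤ) W K p ℓ}) (x y : Vp W K p),
      x ∈ transverseLocalKerP W K p ι ℓ (plK ℓ) → y ∈ transverseLocalKerP W K p ι ℓ (plK ℓ) →
      b (Sum.inr (plK ℓ)) (loc (Sum.inr (plK ℓ)) x) (loc (Sum.inr (plK ℓ)) y) = 0)
    (hstab : ∀ (n : Finset (AdmQ W K p)), n.Nonempty →
      ∀ (ℓ : {ℓ // Zhang2014.IsKolyvaginPrime (W.conductorNorm ℤ) W K p ℓ}) (T : Finset _), ℓ ∉ T →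
      ∀ x : Vp W K p,
        ((∀ w : InfinitePlace K, x ∈ selmerLocalKer (W.baseChange K) w.Completion ((p ^ 1 : ℕ) : ℤ)) ∧
          (∀ v : HeightOneSpectrum (𝓞 K), v ≠ plK ℓ → (∀ ℓ' ∈ T, plK ℓ' ≠ v) →
            ((∀ q ∈ n, ((q : ℕ) : 𝓞 K) ∉ v.asIdeal) →
              x ∈ selmerLocalKer (W.baseChange K) (v.adicCompletion K) ((p ^ 1 : ℕ) : ℤ)) ∧
            (∀ q ∈ n, ((q : ℕ) : 𝓞 K) ∈ v.asIdeal →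
              x ∈ toricLocalKer (W.baseChange K) (v.adicCompletion K) ((p ^ 1 : ℕ) : ℤ))) ∧
          (∀ ℓ' ∈ T, x ∈ transverseLocalKerP W K p ι ℓ' (plK ℓ'))) →
        ((∀ w : InfinitePlace K,
            conjAct W c ((p ^ 1 : ℕ) : ℤ) x ∈ selmerLocalKer (W.baseChange K) w.Completion ((p ^ 1 : ℕ) : ℤ)) ∧
          (∀ v : HeightOneSpectrum (𝓞 K), v ≠ plK ℓ → (∀ ℓ' ∈ T, plK ℓ' ≠ v) →
            ((∀ q ∈ n, ((q : ℕ) : 𝓞 K) ∉ v.asIdeal) →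
              conjAct W c ((p ^ 1 : ℕ) : ℤ) x ∈
                selmerLocalKer (W.baseChange K) (v.adicCompletion K) ((p ^ 1 : ℕ) : ℤ)) ∧
            (∀ q ∈ n, ((q : ℕ) : 𝓞 K) ∈ v.asIdeal →
              conjAct W c ((p ^ 1 : ℕ) : ℤ) x ∈
                toricLocalKer (W.baseChange K) (v.adicCompletion K) ((p ^ 1 : ℕ) : ℤ))) ∧
          (∀ ℓ' ∈ T, conjAct W c ((p ^ 1 : ℕ) : ℤ) x ∈ transverseLocalKerP W K p ι ℓ' (plK ℓ'))))
    (hjump : ∀ (n : Finset (AdmQ W K p)), n.Nonempty →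
      ∀ (ℓ : {ℓ // Zhang2014.IsKolyvaginPrime (W.conductorNorm ℤ) W K p ℓ}) (T : Finset _), ℓ ∉ T →
      ∀ x₀ : Vp W K p, ∃ x : Vp W K p,
        ((∀ w : InfinitePlace K, x ∈ selmerLocalKer (W.baseChange K) w.Completion ((p ^ 1 : ℕ) : ℤ)) ∧
          (∀ v : HeightOneSpectrum (𝓞 K), v ≠ plK ℓ → (∀ ℓ' ∈ T, plK ℓ' ≠ v) →
            ((∀ q ∈ n, ((q : ℕ) : 𝓞 K) ∉ v.asIdeal) →
              x ∈ selmerLocalKer (W.baseChange K) (v.adicCompletion K) ((p ^ 1 : ℕ) : ℤ)) ∧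
            (∀ q ∈ n, ((q : ℕ) : 𝓞 K) ∈ v.asIdeal →
              x ∈ toricLocalKer (W.baseChange K) (v.adicCompletion K) ((p ^ 1 : ℕ) : ℤ))) ∧
          (∀ ℓ' ∈ T, x ∈ transverseLocalKerP W K p ι ℓ' (plK ℓ'))) ∧
        ∀ a : ℤ, x - a • x₀ ∉ (W.baseChange K).torsionLocalKer ((plK ℓ).adicCompletion K) ((p ^ 1 : ℕ) : ℤ))
    (hbound : ∀ (ℓ : {ℓ // Zhang2014.IsKolyvaginPrime (W.conductorNorm ℤ) W K p ℓ}) (s : Bool) (x y : Vp W K p),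
      conjAct W c ((p ^ 1 : ℕ) : ℤ) x = sgnP s • x → conjAct W c ((p ^ 1 : ℕ) : ℤ) y = sgnP s • y →
      b (Sum.inr (plK ℓ)) (loc (Sum.inr (plK ℓ)) x) (loc (Sum.inr (plK ℓ)) x) = 0 →
      b (Sum.inr (plK ℓ)) (loc (Sum.inr (plK ℓ)) x) (loc (Sum.inr (plK ℓ)) y) = 0 →
      b (Sum.inr (plK ℓ)) (loc (Sum.inr (plK ℓ)) y) (loc (Sum.inr (plK ℓ)) x) = 0 →
      b (Sum.inr (plK ℓ)) (loc (Sum.inr (plK ℓ)) y) (loc (Sum.inr (plK ℓ)) y) = 0 →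
      x ∉ (W.baseChange K).torsionLocalKer ((plK ℓ).adicCompletion K) ((p ^ 1 : ℕ) : ℤ) →
      ∃ a : ℤ, y - a • x ∈ (W.baseChange K).torsionLocalKer ((plK ℓ).adicCompletion K) ((p ^ 1 : ℕ) : ℤ)) :
    ∀ (n : Finset (AdmQ W K p)), n.Nonempty →
      ∀ (ℓ : {ℓ // Zhang2014.IsKolyvaginPrime (W.conductorNorm ℤ) W K p ℓ}) (T : Finset _), ℓ ∉ T →
      ∀ s : Bool, ∃ x : Vp W K p, conjAct W c ((p ^ 1 : ℕ) : ℤ) x = sgnP s • x ∧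
        x ∉ (W.baseChange K).torsionLocalKer ((plK ℓ).adicCompletion K) ((p ^ 1 : ℕ) : ℤ) ∧
        b (Sum.inr (plK ℓ)) (loc (Sum.inr (plK ℓ)) x) (loc (Sum.inr (plK ℓ)) x) = 0 ∧
        (∀ w : InfinitePlace K, x ∈ selmerLocalKer (W.baseChange K) w.Completion ((p ^ 1 : ℕ) : ℤ)) ∧
        (∀ v : HeightOneSpectrum (𝓞 K), v ≠ plK ℓ → (∀ ℓ' ∈ T, plK ℓ' ≠ v) →
          ((∀ q ∈ n, ((q : ℕ) : 𝓞 K) ∉ v.asIdeal) →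
            x ∈ selmerLocalKer (W.baseChange K) (v.adicCompletion K) ((p ^ 1 : ℕ) : ℤ)) ∧
          (∀ q ∈ n, ((q : ℕ) : 𝓞 K) ∈ v.asIdeal →
            x ∈ toricLocalKer (W.baseChange K) (v.adicCompletion K) ((p ^ 1 : ℕ) : ℤ))) ∧
        (∀ ℓ' ∈ T, x ∈ transverseLocalKerP W K p ι ℓ' (plK ℓ')) := by
  intro n hn ℓ T hℓT s
  have hp : p.Prime := Fact.out
  let G : AddSubgroup (Vp W K p) :=
    { carrier := {x | (∀ w : InfinitePlace K, x ∈ selmerLocalKer (W.baseChange K) w.Completion ((p ^ 1 : ℕ) : ℤ)) ∧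
        (∀ v : HeightOneSpectrum (𝓞 K), v ≠ plK ℓ → (∀ ℓ' ∈ T, plK ℓ' ≠ v) →
          ((∀ q ∈ n, ((q : ℕ) : 𝓞 K) ∉ v.asIdeal) →
            x ∈ selmerLocalKer (W.baseChange K) (v.adicCompletion K) ((p ^ 1 : ℕ) : ℤ)) ∧
          (∀ q ∈ n, ((q : ℕ) : 𝓞 K) ∈ v.asIdeal →
            x ∈ toricLocalKer (W.baseChange K) (v.adicCompletion K) ((p ^ 1 : ℕ) : ℤ))) ∧
        (∀ ℓ' ∈ T, x ∈ transverseLocalKerP W K p ι ℓ' (plK ℓ'))}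
      add_mem' := fun {x y} hx hy ↦
        ⟨fun w ↦ add_mem (hx.1 w) (hy.1 w),
          fun v hv hvT ↦ ⟨fun hq ↦ add_mem ((hx.2.1 v hv hvT).1 hq) ((hy.2.1 v hv hvT).1 hq),
            fun q hq hqv ↦ add_mem ((hx.2.1 v hv hvT).2 q hq hqv) ((hy.2.1 v hv hvT).2 q hq hqv)⟩,
          fun ℓ' hℓ' ↦ add_mem (hx.2.2 ℓ' hℓ') (hy.2.2 ℓ' hℓ')⟩
      zero_mem' :=
        ⟨fun w ↦ zero_mem _, fun v _ _ ↦ ⟨fun _ ↦ zero_mem _, fun _ _ _ ↦ zero_mem _⟩, fun _ _ ↦ zero_mem _⟩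
      neg_mem' := fun {x} hx ↦
        ⟨fun w ↦ neg_mem (hx.1 w),
          fun v hv hvT ↦ ⟨fun hq ↦ neg_mem ((hx.2.1 v hv hvT).1 hq),
            fun q hq hqv ↦ neg_mem ((hx.2.1 v hv hvT).2 q hq hqv)⟩,
          fun ℓ' hℓ' ↦ neg_mem (hx.2.2 ℓ' hℓ')⟩ }
  set Z := (W.baseChange K).torsionLocalKer ((plK ℓ).adicCompletion K) ((p ^ 1 : ℕ) : ℤ) with hZdef
  have hKumFin : ∀ (v : HeightOneSpectrum (𝓞 K)) (x : Vp W K p),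
      x ∈ selmerLocalKer (W.baseChange K) (v.adicCompletion K) ((p ^ 1 : ℕ) : ℤ) →
        loc (Sum.inr v) x ∈
          (W.baseChange K).kummerLocalConditionAt ((p ^ 1 : ℕ) : ℤ) (Place.Completion (Sum.inr v : Place K)) := by
    intro v x hx; rw [hloc]; exact (mem_selmerLocalKer_iff_localization_mem_kummer_P W K p v x).mp hx
  have hKumInf : ∀ (w : InfinitePlace K) (x : Vp W K p),
      x ∈ selmerLocalKer (W.baseChange K) w.Completion ((p ^ 1 : ℕ) : ℤ) →
        loc (Sum.inl w) x ∈
          (W.baseChange K).kummerLocalConditionAt ((p ^ 1 : ℕ) : ℤ) (Place.Completion (Sum.inl w : Place K)) := by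
    intro w x hx; rw [hloc]; exact (mem_selmerLocalKer_iff_localization_mem_kummer_inf_P W K p w x).mp hx
  have horth : ∀ x y : Vp W K p, x ∈ G → y ∈ G →
      b (Sum.inr (plK ℓ)) (loc (Sum.inr (plK ℓ)) x) (loc (Sum.inr (plK ℓ)) y) = 0 := by
    intro x y hx hy
    have h := hrec x y {(Sum.inr (plK ℓ) : Place K)} fun v hv ↦ ?_
    · rwa [Finset.sum_singleton] at h
    have hv' : v ≠ Sum.inr (plK ℓ) := fun h ↦ hv (Finset.mem_singleton.mpr h)
    rcases v with w | v
    · exact hisoKum (Sum.inl w) _ (hKumInf w x (hx.1 w)) _ (hKumInf w y (hy.1 w))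
    · have hvℓ : v ≠ plK ℓ := fun h ↦ hv' (by rw [h])
      by_cases hvT : ∃ ℓ' ∈ T, plK ℓ' = v
      · obtain ⟨ℓ', hℓ'T, rfl⟩ := hvT
        exact hisoTr ℓ' x y (hx.2.2 ℓ' hℓ'T) (hy.2.2 ℓ' hℓ'T)
      · push Not at hvT
        by_cases hq : ∃ q ∈ n, ((q : ℕ) : 𝓞 K) ∈ v.asIdeal
        · obtain ⟨q, hq, hqv⟩ := hq
          exact hisoTor q v hqv x y ((hx.2.1 v hvℓ hvT).2 q hq hqv) ((hy.2.1 v hvℓ hvT).2 q hq hqv)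
        · push Not at hq
          exact hisoKum (Sum.inr v) _ (hKumFin v x ((hx.2.1 v hvℓ hvT).1 hq)) _
            (hKumFin v y ((hy.2.1 v hvℓ hvT).1 hq))
  have hpV : ∀ a : Vp W K p, p • a = 0 := fun a ↦ by
    rw [← Nat.cast_smul_eq_nsmul (ZMod p), ZMod.natCast_self, zero_smul]
  have hτ : ∀ a : Vp W K p, conjAct W c ((p ^ 1 : ℕ) : ℤ) (conjAct W c ((p ^ 1 : ℕ) : ℤ) a) = a :=
    fun a ↦ conjAct_conjAct_of_mul_self W hc2 _ a
  have hG : ∀ a ∈ G, conjAct W c ((p ^ 1 : ℕ) : ℤ) a ∈ G := fun a ha ↦ hstab n hn ℓ T hℓT a ha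
  have hsgn : sgnP s = 1 ∨ sgnP s = -1 := by cases s <;> simp [sgnP]
  have hsgn' : sgnP (!s) = -sgnP s := by cases s <;> rfl
  have hdec : ∀ x, x ∈ G → ∃ y z, y ∈ G ∧ conjAct W c ((p ^ 1 : ℕ) : ℤ) y = sgnP s • y ∧ z ∈ G ∧
      conjAct W c ((p ^ 1 : ℕ) : ℤ) z = sgnP (!s) • z ∧ x = y + z := by
    intro x hx
    obtain ⟨y, hy, z, hz, hyτ, hzτ, hxyz⟩ :=
      exists_eigen_decomposition (n := p) (hp.odd_of_ne_two hp2) hpV (conjAct W c ((p ^ 1 : ℕ) : ℤ)) hτ hsgn G hG hx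
    exact ⟨y, z, hy, hyτ, hz, by rw [hsgn']; exact hzτ, hxyz⟩
  obtain ⟨x, hxG, hxE, hxZ⟩ := exists_eigen_not_mem_of_jump Z (· ∈ G)
    (fun s' x ↦ conjAct W c ((p ^ 1 : ℕ) : ℤ) x = sgnP s' • x)
    (fun x y ↦ b (Sum.inr (plK ℓ)) (loc (Sum.inr (plK ℓ)) x) (loc (Sum.inr (plK ℓ)) y) = 0) s hdec horth
    (fun x₀ ↦ hjump n hn ℓ T hℓT x₀) (fun x y hx hy ↦ hbound ℓ (!s) x y hx hy)
  exact ⟨x, hxE, hxZ, horth x x hxG hxG, hxG.1, hxG.2.1, hxG.2.2⟩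



/-- **The strong signed supply with (Stab) discharged** (akr-p1's `conjAct_mem_relaxedGroupP`, `c² = 1` from `#Aut(K/ℚ) = 2`).
[cite: WZhang2014, Lemma 8.2] [cite: McCallumLMS1991, Lemma 5.3] [cite: GrossLMS1991, §5 (5.1), Prop. 8.1] -/
theorem supply_signed_strong_of_jump_boundP (hK : IsImaginaryQuadratic K) (hp2 : p ≠ 2) (hc : c ≠ 1)
    (loc : (v : Place K) → Vp W K p →ₗ[ZMod p]
      galoisCohomology (((W.baseChange K).torsionGaloisModule ((p ^ 1 : ℕ) : ℤ)).toLocal v) 1)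
    (hloc : ∀ (v : Place K) (x : Vp W K p),
      loc v x = galoisCohomology.localization ((W.baseChange K).torsionGaloisModule ((p ^ 1 : ℕ) : ℤ)) v 1 x)
    (plK : {ℓ // Zhang2014.IsKolyvaginPrime (W.conductorNorm ℤ) W K p ℓ} → HeightOneSpectrum (𝓞 K))
    (hplK : ∀ ℓ, ((ℓ : ℕ) : 𝓞 K) ∈ (plK ℓ).asIdeal)
    (b : (v : Place K) →
      galoisCohomology (((W.baseChange K).torsionGaloisModule ((p ^ 1 : ℕ) : ℤ)).toLocal v) 1 →ₗ[ZMod p]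
      galoisCohomology (((W.baseChange K).torsionGaloisModule ((p ^ 1 : ℕ) : ℤ)).toLocal v) 1 →ₗ[ZMod p] ZMod p)
    (hrec : ∀ (x y : Vp W K p) (T : Finset (Place K)), (∀ v, v ∉ T → b v (loc v x) (loc v y) = 0) →
      ∑ v ∈ T, b v (loc v x) (loc v y) = 0)
    (hisoKum : ∀ (v : Place K),
      ∀ x ∈ (W.baseChange K).kummerLocalConditionAt ((p ^ 1 : ℕ) : ℤ) (Place.Completion v),
      ∀ y ∈ (W.baseChange K).kummerLocalConditionAt ((p ^ 1 : ℕ) : ℤ) (Place.Completion v), b v x y = 0)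
    (hisoTor : ∀ (q : AdmQ W K p) (v : HeightOneSpectrum (𝓞 K)), ((q : ℕ) : 𝓞 K) ∈ v.asIdeal →
      ∀ (x y : Vp W K p),
      x ∈ toricLocalKer (W.baseChange K) (v.adicCompletion K) ((p ^ 1 : ℕ) : ℤ) →
      y ∈ toricLocalKer (W.baseChange K) (v.adicCompletion K) ((p ^ 1 : ℕ) : ℤ) →
      b (Sum.inr v) (loc (Sum.inr v) x) (loc (Sum.inr v) y) = 0)
    (hisoTr : ∀ (ℓ : {ℓ // Zhang2014.IsKolyvaginPrime (W.conductorNorm ℤ) W K p ℓ}) (x y : Vp W K p),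
      x ∈ transverseLocalKerP W K p ι ℓ (plK ℓ) → y ∈ transverseLocalKerP W K p ι ℓ (plK ℓ) →
      b (Sum.inr (plK ℓ)) (loc (Sum.inr (plK ℓ)) x) (loc (Sum.inr (plK ℓ)) y) = 0)
    (hjump : ∀ (n : Finset (AdmQ W K p)), n.Nonempty →
      ∀ (ℓ : {ℓ // Zhang2014.IsKolyvaginPrime (W.conductorNorm ℤ) W K p ℓ}) (T : Finset _), ℓ ∉ T →
      ∀ x₀ : Vp W K p, ∃ x : Vp W K p,
        ((∀ w : InfinitePlace K, x ∈ selmerLocalKer (W.baseChange K) w.Completion ((p ^ 1 : ℕ) : ℤ)) ∧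
          (∀ v : HeightOneSpectrum (𝓞 K), v ≠ plK ℓ → (∀ ℓ' ∈ T, plK ℓ' ≠ v) →
            ((∀ q ∈ n, ((q : ℕ) : 𝓞 K) ∉ v.asIdeal) →
              x ∈ selmerLocalKer (W.baseChange K) (v.adicCompletion K) ((p ^ 1 : ℕ) : ℤ)) ∧
            (∀ q ∈ n, ((q : ℕ) : 𝓞 K) ∈ v.asIdeal →
              x ∈ toricLocalKer (W.baseChange K) (v.adicCompletion K) ((p ^ 1 : ℕ) : ℤ))) ∧
          (∀ ℓ' ∈ T, x ∈ transverseLocalKerP W K p ι ℓ' (plK ℓ'))) ∧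
        ∀ a : ℤ, x - a • x₀ ∉ (W.baseChange K).torsionLocalKer ((plK ℓ).adicCompletion K) ((p ^ 1 : ℕ) : ℤ))
    (hbound : ∀ (ℓ : {ℓ // Zhang2014.IsKolyvaginPrime (W.conductorNorm ℤ) W K p ℓ}) (s : Bool) (x y : Vp W K p),
      conjAct W c ((p ^ 1 : ℕ) : ℤ) x = sgnP s • x → conjAct W c ((p ^ 1 : ℕ) : ℤ) y = sgnP s • y →
      b (Sum.inr (plK ℓ)) (loc (Sum.inr (plK ℓ)) x) (loc (Sum.inr (plK ℓ)) x) = 0 →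
      b (Sum.inr (plK ℓ)) (loc (Sum.inr (plK ℓ)) x) (loc (Sum.inr (plK ℓ)) y) = 0 →
      b (Sum.inr (plK ℓ)) (loc (Sum.inr (plK ℓ)) y) (loc (Sum.inr (plK ℓ)) x) = 0 →
      b (Sum.inr (plK ℓ)) (loc (Sum.inr (plK ℓ)) y) (loc (Sum.inr (plK ℓ)) y) = 0 →
      x ∉ (W.baseChange K).torsionLocalKer ((plK ℓ).adicCompletion K) ((p ^ 1 : ℕ) : ℤ) →
      ∃ a : ℤ, y - a • x ∈ (W.baseChange K).torsionLocalKer ((plK ℓ).adicCompletion K) ((p ^ 1 : ℕ) : ℤ)) :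
    ∀ (n : Finset (AdmQ W K p)), n.Nonempty →
      ∀ (ℓ : {ℓ // Zhang2014.IsKolyvaginPrime (W.conductorNorm ℤ) W K p ℓ}) (T : Finset _), ℓ ∉ T →
      ∀ s : Bool, ∃ x : Vp W K p, conjAct W c ((p ^ 1 : ℕ) : ℤ) x = sgnP s • x ∧
        x ∉ (W.baseChange K).torsionLocalKer ((plK ℓ).adicCompletion K) ((p ^ 1 : ℕ) : ℤ) ∧
        b (Sum.inr (plK ℓ)) (loc (Sum.inr (plK ℓ)) x) (loc (Sum.inr (plK ℓ)) x) = 0 ∧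
        (∀ w : InfinitePlace K, x ∈ selmerLocalKer (W.baseChange K) w.Completion ((p ^ 1 : ℕ) : ℤ)) ∧
        (∀ v : HeightOneSpectrum (𝓞 K), v ≠ plK ℓ → (∀ ℓ' ∈ T, plK ℓ' ≠ v) →
          ((∀ q ∈ n, ((q : ℕ) : 𝓞 K) ∉ v.asIdeal) →
            x ∈ selmerLocalKer (W.baseChange K) (v.adicCompletion K) ((p ^ 1 : ℕ) : ℤ)) ∧
          (∀ q ∈ n, ((q : ℕ) : 𝓞 K) ∈ v.asIdeal →
            x ∈ toricLocalKer (W.baseChange K) (v.adicCompletion K) ((p ^ 1 : ℕ) : ℤ))) ∧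
        (∀ ℓ' ∈ T, x ∈ transverseLocalKerP W K p ι ℓ' (plK ℓ')) := by
  have hc2 : c * c = 1 := by
    haveI : Algebra.IsQuadraticExtension ℚ K := ⟨hK.1⟩
    have hcard : Nat.card (K ≃ₐ[ℚ] K) = 2 := by rw [IsGalois.card_aut_eq_finrank, hK.1]
    obtain ⟨y, -, hy⟩ := (Nat.card_eq_two_iff' (1 : K ≃ₐ[ℚ] K)).mp hcard
    by_contra h
    have h1 : c * c = y := hy _ h
    have h2 : c = y := hy _ hc
    rw [← h2] at h1
    exact hc (mul_left_cancel (h1.trans (mul_one c).symm))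
  have hcur := ne_plK_iff_not_mem W K p plK hplK
  refine supply_signed_strong_of_jumpP W K p ι c hp2 hc2 loc hloc plK b hrec hisoKum hisoTor hisoTr ?_ hjump hbound
  intro n _ ℓ T _ x hx
  have hx' : (∀ w : InfinitePlace K, x ∈ selmerLocalKer (W.baseChange K) w.Completion ((p ^ 1 : ℕ) : ℤ)) ∧
      (∀ v : HeightOneSpectrum (𝓞 K), ((ℓ : ℕ) : 𝓞 K) ∉ v.asIdeal →
        (∀ ℓ' ∈ T, ((ℓ' : ℕ) : 𝓞 K) ∉ v.asIdeal) →
        ((∀ q ∈ n, ((q : ℕ) : 𝓞 K) ∉ v.asIdeal) →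
          x ∈ selmerLocalKer (W.baseChange K) (v.adicCompletion K) ((p ^ 1 : ℕ) : ℤ)) ∧
        (∀ q ∈ n, ((q : ℕ) : 𝓞 K) ∈ v.asIdeal →
          x ∈ toricLocalKer (W.baseChange K) (v.adicCompletion K) ((p ^ 1 : ℕ) : ℤ))) ∧
      (∀ ℓ' ∈ T, ∀ v : HeightOneSpectrum (𝓞 K), ((ℓ' : ℕ) : 𝓞 K) ∈ v.asIdeal →
        x ∈ transverseLocalKerP W K p ι ℓ' v) := by
    refine ⟨hx.1, fun v hv hvT ↦ hx.2.1 v ((hcur ℓ v).mpr hv) (fun ℓ' hℓ' ↦ ((hcur ℓ' v).mpr (hvT ℓ' hℓ')).symm),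
      fun ℓ' hℓ' v hv ↦ ?_⟩
    have hveq : v = plK ℓ' := by
      by_contra hne
      exact (hcur ℓ' v).mp hne hv
    rw [hveq]
    exact hx.2.2 ℓ' hℓ'
  have h := conjAct_mem_relaxedGroupP W p hK hc ι n ℓ T x hx'
  exact ⟨h.1, fun v hv hvT ↦ h.2.1 v ((hcur ℓ v).mp hv) (fun ℓ' hℓ' ↦ (hcur ℓ' v).mp (hvT ℓ' hℓ').symm),
    fun ℓ' hℓ' ↦ h.2.2 ℓ' hℓ' (plK ℓ') (hplK ℓ')⟩

/-! ## §2 The strong signed jump from the Poitou–Tate fact, in the cup-product currency of the axis lemma -/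

section PoitouTate

variable [W.IsElliptic] [∀ v : Place K, CompactSpace (absoluteGaloisGroup (Place.Completion v))]
  [Finite (geomTorsion (W.baseChange K) ((p ^ 1 : ℕ) : ℤ))]

/-- **The STRONG signed jump at a Kolyvagin prime, from the Poitou–Tate fact** (place currency; any Weil-type pairing `e`): for every
non-empty admissible level `n`, Kolyvagin `ℓ ∉ T`, sign `s`, a class `x` with `c_* x = sgnP s · x`, NOT locally trivial above `ℓ`,
`loc_λ x ∪ₑ loc_λ x = 0`, Kummer at `∞` and off `ℓ`, `T`, `n`, TORIC above `n`, TRANSVERSE above `T` (akr-p1's `hSupply_of_poitouTateP` assembly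
feeding §1). [cite: WZhang2014, Lemma 8.2] [cite: McCallumLMS1991, Lemma 5.3] [cite: MilneADT2006, Ch. I, Cor. 2.3, Thm. 4.10] -/
theorem strongSupply_of_poitouTateP (hK : IsImaginaryQuadratic K) (hp2 : p ≠ 2) (hd : NumberField.discr K < -4)
    (hsurj : W.HasSurjectiveModNGaloisRep p) (hc : c ≠ 1) (hPT : poitouTate_selmerStructure_duality K)
    (e : geomTorsion (W.baseChange K) ((p ^ 1 : ℕ) : ℤ) → geomTorsion (W.baseChange K) ((p ^ 1 : ℕ) : ℤ) →
      AlgebraicClosure K)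
    (hμ : ∀ P Q, e P Q ^ (p ^ 1) = 1) (hadd₁ : ∀ P₁ P₂ Q, e (P₁ + P₂) Q = e P₁ Q * e P₂ Q)
    (hadd₂ : ∀ P Q₁ Q₂, e P (Q₁ + Q₂) = e P Q₁ * e P Q₂) (halt : ∀ Q, e Q Q = 1)
    (hnondeg : ∀ Q, (∀ P, e P Q = 1) → Q = 0)
    (hgal : ∀ (σ : absoluteGaloisGroup K) (P Q : geomTorsion (W.baseChange K) ((p ^ 1 : ℕ) : ℤ)),
      σ • e P Q = e (σ • P) (σ • Q)) :
    ∀ (n : Finset (AdmQ W K p)), n.Nonempty →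
      ∀ (ℓ : {ℓ // Zhang2014.IsKolyvaginPrime (W.conductorNorm ℤ) W K p ℓ})
        (T : Finset {ℓ // Zhang2014.IsKolyvaginPrime (W.conductorNorm ℤ) W K p ℓ}), ℓ ∉ T →
      ∀ s : Bool, ∃ x : Vp W K p, conjAct W c ((p ^ 1 : ℕ) : ℤ) x = sgnP s • x ∧
        (∀ v : HeightOneSpectrum (𝓞 K), ((ℓ : ℕ) : 𝓞 K) ∈ v.asIdeal →
          x ∉ (W.baseChange K).torsionLocalKer (v.adicCompletion K) ((p ^ 1 : ℕ) : ℤ) ∧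
          (weilContPairingLocal (W.baseChange K) (p ^ 1) e hμ hadd₁ hadd₂ hgal (Sum.inr v)).cupProduct
            (galoisCohomology.localization ((W.baseChange K).torsionGaloisModule ((p ^ 1 : ℕ) : ℤ)) (Sum.inr v) 1 x)
            (galoisCohomology.localization ((W.baseChange K).torsionGaloisModule ((p ^ 1 : ℕ) : ℤ)) (Sum.inr v) 1 x) = 0) ∧
        (∀ w : InfinitePlace K, x ∈ selmerLocalKer (W.baseChange K) w.Completion ((p ^ 1 : ℕ) : ℤ)) ∧
        (∀ v : HeightOneSpectrum (𝓞 K), ((ℓ : ℕ) : 𝓞 K) ∉ v.asIdeal →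
          (∀ ℓ' ∈ T, ((ℓ' : ℕ) : 𝓞 K) ∉ v.asIdeal) →
          ((∀ q ∈ n, ((q : ℕ) : 𝓞 K) ∉ v.asIdeal) →
            x ∈ selmerLocalKer (W.baseChange K) (v.adicCompletion K) ((p ^ 1 : ℕ) : ℤ)) ∧
          (∀ q ∈ n, ((q : ℕ) : 𝓞 K) ∈ v.asIdeal →
            x ∈ toricLocalKer (W.baseChange K) (v.adicCompletion K) ((p ^ 1 : ℕ) : ℤ))) ∧
        (∀ ℓ' ∈ T, ∀ v : HeightOneSpectrum (𝓞 K), ((ℓ' : ℕ) : 𝓞 K) ∈ v.asIdeal →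
          x ∈ transverseLocalKerP W K p ι ℓ' v) := by
  intro n hn ℓ T hℓT s
  have hp : p.Prime := Fact.out
  haveI : IsTotallyComplex K := hK.2
  haveI : NeZero (p ^ 1 : ℕ) := ⟨pow_ne_zero 1 hp.ne_zero⟩
  let plK : {ℓ // Zhang2014.IsKolyvaginPrime (W.conductorNorm ℤ) W K p ℓ} → HeightOneSpectrum (𝓞 K) := fun ℓ ↦
    ⟨Ideal.span {((ℓ : ℕ) : 𝓞 K)}, ℓ.2.2.2.2.2.1, by
      rw [Ne, Ideal.span_singleton_eq_bot]; exact_mod_cast ℓ.2.1.ne_zero⟩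
  have hplK : ∀ ℓ, ((ℓ : ℕ) : 𝓞 K) ∈ (plK ℓ).asIdeal := fun ℓ ↦ Ideal.mem_span_singleton_self _
  have hcur := ne_plK_iff_not_mem W K p plK hplK
  let ρ := (W.baseChange K).torsionGaloisModule ((p ^ 1 : ℕ) : ℤ)
  let loc : (v : Place K) → Vp W K p →ₗ[ZMod p] galoisCohomology (ρ.toLocal v) 1 := fun v ↦
    (show Vp W K p →+ galoisCohomology (ρ.toLocal v) 1 from galoisCohomology.localization ρ v 1).toZModLinearMap p
  have hloc : ∀ (v : Place K) (x : Vp W K p), loc v x = galoisCohomology.localization ρ v 1 x := fun _ _ ↦ rfl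
  obtain ⟨inv, hinvperf, hPTsum⟩ := poitouTate_sum_localTatePairing_eq_zero_of_isTotallyComplex K (p ^ 1)
  obtain ⟨b, hb⟩ := exists_zmodBilinear_invCupProduct_P W K p e hμ hadd₁ hadd₂ hgal inv
  have hinj : ∀ v : HeightOneSpectrum (𝓞 K), Injective (inv (Sum.inr v)) := fun v ↦ (hinvperf v).1.1
  have hrec : ∀ (x y : Vp W K p) (T : Finset (Place K)), (∀ v, v ∉ T → b v (loc v x) (loc v y) = 0) →
      ∑ v ∈ T, b v (loc v x) (loc v y) = 0 := fun x y T hT ↦ sum_invCupProduct_eq_zero_P W K p hb hPTsum x y T hT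
  have hisoKum := fun v ↦ invCupProduct_eq_zero_of_mem_kummer_P W K p hb halt v
  have hisoTor : ∀ (q : AdmQ W K p) (v : HeightOneSpectrum (𝓞 K)), ((q : ℕ) : 𝓞 K) ∈ v.asIdeal →
      ∀ (x y : Vp W K p),
      x ∈ toricLocalKer (W.baseChange K) (v.adicCompletion K) ((p ^ 1 : ℕ) : ℤ) →
      y ∈ toricLocalKer (W.baseChange K) (v.adicCompletion K) ((p ^ 1 : ℕ) : ℤ) →
      b (Sum.inr v) (loc (Sum.inr v) x) (loc (Sum.inr v) y) = 0 :=
    fun q v hqv x y hx hy ↦ invCupProduct_eq_zero_of_mem_toric_P W K p hb hK.1 halt q v hqv x y hx hy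
  have hisoTr : ∀ (ℓ : {ℓ // Zhang2014.IsKolyvaginPrime (W.conductorNorm ℤ) W K p ℓ}) (x y : Vp W K p),
      x ∈ transverseLocalKerP W K p ι ℓ (plK ℓ) → y ∈ transverseLocalKerP W K p ι ℓ (plK ℓ) →
      b (Sum.inr (plK ℓ)) (loc (Sum.inr (plK ℓ)) x) (loc (Sum.inr (plK ℓ)) y) = 0 := by
    intro ℓ x y hx hy
    rw [hb, hloc, hloc, cupProduct_eq_zero_of_mem_transverseLocalKerP W K p hK ι hp2 e hμ hadd₁ hadd₂ hgal ℓ ℓ.2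
      (plK ℓ) (hplK ℓ) x y hx hy]
    exact (congrArg (ZMod.ringEquivCongr (pow_one p)) (map_zero (inv (Sum.inr (plK ℓ))))).trans (map_zero _)
  have hjump := hjump_of_poitouTateP W K p hK hp2 hd hPT ι plK hplK
  have hcup0 : ∀ (ℓ : {ℓ // Zhang2014.IsKolyvaginPrime (W.conductorNorm ℤ) W K p ℓ}) (x y : Vp W K p),
      b (Sum.inr (plK ℓ)) (loc (Sum.inr (plK ℓ)) x) (loc (Sum.inr (plK ℓ)) y) = 0 →
      (weilContPairingLocal (W.baseChange K) (p ^ 1) e hμ hadd₁ hadd₂ hgal (Sum.inr (plK ℓ))).cupProduct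
        (galoisCohomology.localization ((W.baseChange K).torsionGaloisModule ((p ^ 1 : ℕ) : ℤ)) (Sum.inr (plK ℓ)) 1 x)
        (galoisCohomology.localization ((W.baseChange K).torsionGaloisModule ((p ^ 1 : ℕ) : ℤ)) (Sum.inr (plK ℓ)) 1 y)
          = 0 := by
    intro ℓ x y h
    rw [hb, hloc, hloc] at h
    have h' := (EmbeddingLike.map_eq_zero_iff (f := ZMod.ringEquivCongr (pow_one p))).mp h
    exact hinj _ (h'.trans (map_zero _).symm)
  have hbound : ∀ (ℓ : {ℓ // Zhang2014.IsKolyvaginPrime (W.conductorNorm ℤ) W K p ℓ}) (s : Bool) (x y : Vp W K p),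
      conjAct W c ((p ^ 1 : ℕ) : ℤ) x = sgnP s • x → conjAct W c ((p ^ 1 : ℕ) : ℤ) y = sgnP s • y →
      b (Sum.inr (plK ℓ)) (loc (Sum.inr (plK ℓ)) x) (loc (Sum.inr (plK ℓ)) x) = 0 →
      b (Sum.inr (plK ℓ)) (loc (Sum.inr (plK ℓ)) x) (loc (Sum.inr (plK ℓ)) y) = 0 →
      b (Sum.inr (plK ℓ)) (loc (Sum.inr (plK ℓ)) y) (loc (Sum.inr (plK ℓ)) x) = 0 →
      b (Sum.inr (plK ℓ)) (loc (Sum.inr (plK ℓ)) y) (loc (Sum.inr (plK ℓ)) y) = 0 →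
      x ∉ (W.baseChange K).torsionLocalKer ((plK ℓ).adicCompletion K) ((p ^ 1 : ℕ) : ℤ) →
      ∃ a : ℤ, y - a • x ∈ (W.baseChange K).torsionLocalKer ((plK ℓ).adicCompletion K) ((p ^ 1 : ℕ) : ℤ) :=
    fun ℓ s x y hxs hys h11 h12 h21 h22 hx0 ↦
      sub_zsmul_mem_torsionLocalKer_of_isotropic_P W K p hK hp2 hsurj hc e hμ hadd₁ hadd₂ halt hnondeg hgal ℓ.2 (plK ℓ)
        (hplK ℓ) s hxs hys (hcup0 ℓ x x h11) (hcup0 ℓ x y h12) (hcup0 ℓ y x h21) (hcup0 ℓ y y h22) hx0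
  obtain ⟨x, hxs, hxZ, hxx, hinf, hfin, htr⟩ :=
    supply_signed_strong_of_jump_boundP W K p ι c hK hp2 hc loc hloc plK hplK b hrec hisoKum hisoTor hisoTr hjump hbound
      n hn ℓ T hℓT s
  refine ⟨x, hxs, fun v hv ↦ ?_, hinf, fun v hv hvT ↦ hfin v ((hcur ℓ v).mpr hv)
    (fun ℓ' hℓ' ↦ ((hcur ℓ' v).mpr (hvT ℓ' hℓ')).symm), fun ℓ' hℓ' v hv ↦ ?_⟩
  · have hveq : v = plK ℓ := by
      by_contra hne
      exact (hcur ℓ v).mp hne hv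
    subst hveq
    exact ⟨hxZ, hcup0 ℓ x x hxx⟩
  · have hveq : v = plK ℓ' := by
      by_contra hne
      exact (hcur ℓ' v).mp hne hv
    rw [hveq]
    exact htr ℓ' hℓ'

end PoitouTate

end Summit.BirchSwinnertonDyer.BirchSwinnertonDyer.Theorems.AdditiveKoly

end
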